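import Summits.Parity.GeneralizedHardyLittlewood.Theses.LiouvilleShiftedTables
import Summits.Parity.GeneralizedHardyLittlewood.Theorems.TableChowla.Negative.TableChowlaEveryLevelFaces
import Summits.Parity.GeneralizedHardyLittlewood.Theorems.TableChowla.Negative.TableChowlaOperatorNorm
import Summits.Parity.GeneralizedHardyLittlewood.Theorems.TableChowla.Negative.TableChowlaExceptionalSet

/-!
# STRATEGY CENSUS for the crux `TableChowla` (stmt-Parity-14270) — typed attempts

Companion Lean file of `Cruxes/TableChowla/STRATEGY-CENSUS.md` (crux-strategist wall-breaker seat
`planner-cstrat-stmt-Parity-14270-p1-0`, 2026-08-17).  It contains NO stub and NO `TableChowla_of`: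
it is not a line.  It records, as elaborating signatures over the landed `Negative/*` vocabulary, the
strengthen / decomposition attempts of the census, and proves the one glue that is free
(the window split), so that the census's claims "typed" and "glue provable" are kernel facts.

* §S6  `SchurRowForm`            — sup-over-rows strengthening (Schur test)           [signature]
* §S7  `ShiftUniformTableChowla` — shift-uniform strengthening (enables Hecke moves)   [signature]
* §S8  `MontgomeryLiouvilleAP`   — pointwise square-root hypothesis for `λ` in APs     [signature]
* §D3  `F1Var`, `MeanZeroOpNorm`  — mean / fluctuation split of the operator-norm form  [signatures]
* §D4  `TableChowlaLow`, `TableChowlaHigh`, `tableChowla_of_window_split`              [PROVED glue]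
       and `fixedResidueLevel_of_low` : the LOW piece alone already carries the every-level
       fixed-residue face at all levels `θ ∈ [5/6, 1)` (the Montgomery-strength content).
[folklore]
-/

namespace Summit.Parity.GeneralizedHardyLittlewood.Cruxes.TableChowla.StrategyCensus

open Finset Real
open Summit.Parity.GeneralizedHardyLittlewood.Theses
open Summit.Parity.GeneralizedHardyLittlewood.Theorems.TableChowla.Negative

noncomputable section

/-! ## §S6 — Schur / sup-over-rows form (strengthening) -/

/-- STRENGTHENING S6 (Schur test).  For EVERY row `a` of the table, the `ℓ¹` mass of its
correlations with the other rows is small: `Σ_{a' ∈ rows} |S(a,a')| ≤ x/(log x)^C`.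
(`‖MMᵀ‖_op ≤ max_a Σ_{a'} |S(a,a')|`, so this implies the operator-norm form, hence the crux.)
Per row this reads: `λ` in the progressions `c (mod a')`, `a' ≤ 2x^{5/12}` (Bombieri–Vinogradov
range!) but TWISTED by the fixed `±1` sequence `b ↦ λ(ab+c)` — the twist is the whole difficulty,
and the statement still implies the every-level fixed-residue face. -/
def SchurRowForm : Prop :=
  ∀ c : ℤ, c ≠ 0 → ∀ δ : ℝ, 0 < δ → δ ≤ 1 / 12 → ∀ C : ℝ, 0 < C → ∃ x₀ : ℝ, ∀ x : ℝ, x₀ ≤ x →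
    ∀ A : ℝ, x ^ δ ≤ A → A ≤ x ^ (1 / 3 + δ) → ∀ a ∈ Ioc ⌊A⌋₊ ⌊2 * A⌋₊,
      (∑ a' ∈ Ioc ⌊A⌋₊ ⌊2 * A⌋₊, |rowCorr lam c ⌊x / A⌋₊ a a'|) ≤ x / Real.log x ^ C

/-! ## §S7 — shift-uniform form (strengthening) -/

/-- STRENGTHENING S7 (shift uniformity, exponent `κ`): one threshold `x₀(δ, C)` serves every shift
`0 < |c| ≤ x^κ`.  This is what the Hecke moves `c ↦ pc` (`λ(p(ab+c)) = −λ(ab+c)`) would need; each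
such move realises the `c`-table as a slice of density `1/p` (or `1/p²`) of a `pc`-table and the
fourth moment loses exactly that density (obstruction O1 of IDEATE-r2-i4), so the extra uniformity
buys nothing for THIS step. -/
def ShiftUniformTableChowla (κ : ℝ) : Prop :=
  ∀ δ : ℝ, 0 < δ → δ ≤ 1 / 12 → ∀ C : ℝ, 0 < C → ∃ x₀ : ℝ, ∀ x : ℝ, x₀ ≤ x →
    ∀ c : ℤ, c ≠ 0 → (|c| : ℝ) ≤ x ^ κ →
    ∀ A : ℝ, x ^ δ ≤ A → A ≤ x ^ (1 / 3 + δ) →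
      momentN lam c ⌊A⌋₊ ⌊2 * A⌋₊ ⌊x / A⌋₊ ≤ x ^ 2 / Real.log x ^ C

/-! ## §S8 — a Montgomery-type hypothesis for `λ` in progressions -/

/-- HYPOTHESIS S8 (Montgomery-type, pointwise square-root cancellation for `λ` in arithmetic
progressions, every modulus `q ≤ y`, every residue): `|Σ_{n ≤ y, n ≡ r (q)} λ(n)| ≤ (y/q)^{1/2}·y^ε`.
Far beyond GRH.  It implies the every-level fixed-residue face `FixedResidueLevel θ` (θ < 1) but
NOT the crux: the two-point part (row `a'` twisted against row `a`) is untouched by any one-point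
hypothesis.  Recorded to make precise that the crux is "Montgomery ∧ Chowla", not "Montgomery". -/
def MontgomeryLiouvilleAP : Prop :=
  ∀ ε : ℝ, 0 < ε → ∃ y₀ : ℝ, ∀ y : ℝ, y₀ ≤ y → ∀ q : ℕ, 1 ≤ q → (q : ℝ) ≤ y → ∀ r : ℕ,
    |∑ n ∈ (Icc 1 ⌊y⌋₊).filter (fun n : ℕ => n ≡ r [MOD q]), lam n| ≤
      (y / q) ^ (1 / 2 : ℝ) * y ^ ε

/-! ## §D3 — mean / fluctuation split of the operator-norm form -/

/-- PIECE D3a — the MEAN (one-point) part: the variance form of the fixed-residue face,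
`Σ_{b ≤ x/A} (Σ_{a ∈ rows} λ(ab+c))² ≤ A·x/(log x)^C` (= `Σ_{a,a'} S(a,a')`, the SIGNED mean of the
pair correlations; implied by the crux via `rows·√T`). -/
def F1Var : Prop :=
  ∀ c : ℤ, c ≠ 0 → ∀ δ : ℝ, 0 < δ → δ ≤ 1 / 12 → ∀ C : ℝ, 0 < C → ∃ x₀ : ℝ, ∀ x : ℝ, x₀ ≤ x →
    ∀ A : ℝ, x ^ δ ≤ A → A ≤ x ^ (1 / 3 + δ) →
      (∑ b ∈ Icc 1 ⌊x / A⌋₊, colSum lam c ⌊A⌋₊ ⌊2 * A⌋₊ b ^ 2) ≤ A * x / Real.log x ^ C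

/-- PIECE D3b — the FLUCTUATION part: the operator-norm form restricted to MEAN-ZERO row test
vectors (`Σ_a u_a = 0`).  Glue (routine, not filed): write `u = u₀ + ū·𝟙`; `|ū|·|𝟙ᵀMv| ≤ √(V/rows)`
with `V` the `F1Var` sum, so `F1Var ∧ MeanZeroOpNorm → OperatorNormForm → TableChowla`
(`operatorNormForm_iff`, p73186).  But D3b is still the whole crux in species: the mean-zero
direction `u = (𝟙_{a even} − 𝟙_{a odd})/√rows` gives the fixed-residue face for the DIFFERENCE of
the classes `c`, `c+b (mod 2b)`, `b ≤ x^{1−δ}` — the same Montgomery-strength content. -/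
def MeanZeroOpNorm : Prop :=
  ∀ c : ℤ, c ≠ 0 → ∀ δ : ℝ, 0 < δ → δ ≤ 1 / 12 → ∀ C : ℝ, 0 < C → ∃ x₀ : ℝ, ∀ x : ℝ, x₀ ≤ x →
    ∀ A : ℝ, x ^ δ ≤ A → A ≤ x ^ (1 / 3 + δ) →
    ∀ u v : ℕ → ℝ, (∑ a ∈ Ioc ⌊A⌋₊ ⌊2 * A⌋₊, u a ^ 2 ≤ 1) → (∑ a ∈ Ioc ⌊A⌋₊ ⌊2 * A⌋₊, u a = 0) →
      (∑ b ∈ Icc 1 ⌊x / A⌋₊, v b ^ 2 ≤ 1) →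
      |∑ a ∈ Ioc ⌊A⌋₊ ⌊2 * A⌋₊, ∑ b ∈ Icc 1 ⌊x / A⌋₊, u a * v b * entry c a b| ≤
        x ^ (1 / 2 : ℝ) / Real.log x ^ C

/-! ## §D4 — the window split by `log A / log x` (glue proved) -/

/-- PIECE D4-LOW: the crux on the lower window `x^δ ≤ A ≤ x^{1/6}` (short rows). Written with the
landed `moment` (definitionally the crux's double sum, cf. `tableChowla_iff : … ↔ TableChowlaFor lam`
by `Iff.rfl`).  This piece ALONE carries `FixedResidueLevel θ` for every `θ ∈ [5/6, 1)`
(`fixedResidueLevel_of_low`): the Montgomery-strength content of the crux lives here. -/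
def TableChowlaLow : Prop :=
  ∀ c : ℤ, c ≠ 0 → ∀ δ : ℝ, 0 < δ → δ ≤ 1 / 12 → ∀ C : ℝ, 0 < C → ∃ x₀ : ℝ, ∀ x : ℝ, x₀ ≤ x →
    ∀ A : ℝ, x ^ δ ≤ A → A ≤ x ^ (1 / 6 : ℝ) → moment lam c x A ≤ x ^ 2 / Real.log x ^ C

/-- PIECE D4-HIGH: the crux on the upper window `x^{1/6} ≤ A ≤ x^{1/3+δ}` (this piece carries
`FixedResidueLevel θ` for `θ ∈ [7/12, 5/6]` — fixed residue, absolute values, every log power, far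
beyond the print frontier `17/33` (Fouvry–Radziwiłł) — AND the two-point core). -/
def TableChowlaHigh : Prop :=
  ∀ c : ℤ, c ≠ 0 → ∀ δ : ℝ, 0 < δ → δ ≤ 1 / 12 → ∀ C : ℝ, 0 < C → ∃ x₀ : ℝ, ∀ x : ℝ, x₀ ≤ x →
    ∀ A : ℝ, x ^ (1 / 6 : ℝ) ≤ A → A ≤ x ^ (1 / 3 + δ) → moment lam c x A ≤ x ^ 2 / Real.log x ^ C

/-- **GLUE D4** (the only free glue of the census): the two window pieces give the crux by a case
split on `A ≤ x^{1/6}`.  Typed and proved to show the split is genuine — and that it has no teeth: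
each piece is conjecture-grade on its own window. -/
theorem tableChowla_of_window_split (hlow : TableChowlaLow) (hhigh : TableChowlaHigh) :
    LiouvilleShiftedTables.TableChowla := by
  rw [tableChowla_iff]
  intro c hc δ hδ hδ' C hC
  obtain ⟨x₁, hx₁⟩ := hlow c hc δ hδ hδ' C hC
  obtain ⟨x₂, hx₂⟩ := hhigh c hc δ hδ hδ' C hC
  refine ⟨max x₁ x₂, fun x hx A hA hA' => ?_⟩
  rcases le_total A (x ^ (1 / 6 : ℝ)) with h | h
  · exact hx₁ x (le_trans (le_max_left _ _) hx) A hA h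
  · exact hx₂ x (le_trans (le_max_right _ _) hx) A h hA'

/-- Conversely both pieces are sub-statements of the crux (so the split is exact). -/
theorem low_of_tableChowla (h : LiouvilleShiftedTables.TableChowla) : TableChowlaLow := by
  rw [tableChowla_iff] at h
  intro c hc δ hδ hδ' C hC
  obtain ⟨x₀, hx₀⟩ := h c hc δ hδ hδ' C hC
  refine ⟨max x₀ 1, fun x hx A hA hA' => hx₀ x (le_trans (le_max_left _ _) hx) A hA ?_⟩
  have hx1 : 1 ≤ x := le_trans (le_max_right _ _) hx
  exact le_trans hA' (Real.rpow_le_rpow_of_exponent_le hx1 (by linarith))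

theorem high_of_tableChowla (h : LiouvilleShiftedTables.TableChowla) : TableChowlaHigh := by
  rw [tableChowla_iff] at h
  intro c hc δ hδ hδ' C hC
  obtain ⟨x₀, hx₀⟩ := h c hc δ hδ hδ' C hC
  refine ⟨max x₀ 1, fun x hx A hA hA' => hx₀ x (le_trans (le_max_left _ _) hx) A ?_ hA'⟩
  have hx1 : 1 ≤ x := le_trans (le_max_right _ _) hx
  exact le_trans (Real.rpow_le_rpow_of_exponent_le hx1 (by linarith)) hA

/-- `TableChowla ↔ TableChowlaLow ∧ TableChowlaHigh`. -/
theorem tableChowla_iff_window_split :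
    LiouvilleShiftedTables.TableChowla ↔ TableChowlaLow ∧ TableChowlaHigh :=
  ⟨fun h => ⟨low_of_tableChowla h, high_of_tableChowla h⟩,
    fun h => tableChowla_of_window_split h.1 h.2⟩

/-- **The LOW piece alone implies `FixedResidueLevel θ` for every `θ ∈ [5/6, 1)`** — the proof of
the landed `fixedResidueFace_of_tableChowla` (two Cauchy–Schwarz steps, `sq_sum_abs_colSum_le`)
run on the sub-window at `A = x^{1−θ} ≤ x^{1/6}`, `δ = min (1/12) (1−θ)`.  So whichever seat holds
the LOW child holds fixed-residue `|·|`-level `θ → 1` for `λ` with every log-power saving. -/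
theorem fixedResidueLevel_of_low (hlow : TableChowlaLow) {θ : ℝ} (hθ : 5 / 6 ≤ θ) (hθ' : θ < 1) :
    FixedResidueLevel θ := by
  intro c hc C hC
  set δ : ℝ := min (1 / 12) (1 - θ) with hδdef
  have hδpos : 0 < δ := lt_min (by norm_num) (by linarith)
  have hδle : δ ≤ 1 / 12 := min_le_left _ _
  have hδle' : δ ≤ 1 - θ := min_le_right _ _
  obtain ⟨x₀, hx₀⟩ := hlow c hc δ hδpos hδle (4 * C + 4) (by positivity)
  obtain ⟨X, hX⟩ := eventually_rpow_log_ge hC 0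
  refine ⟨max x₀ (max X 1), fun x hx => ?_⟩
  have hx₀x : x₀ ≤ x := le_trans (le_max_left _ _) hx
  have hxX : X ≤ x := le_trans (le_trans (le_max_left _ _) (le_max_right _ _)) hx
  have hx1 : 1 ≤ x := le_trans (le_trans (le_max_right _ _) (le_max_right _ _)) hx
  have hxpos : 0 < x := by linarith
  obtain ⟨_, hlog2⟩ := hX x hxX
  have hlogpos : 0 < Real.log x := by linarith
  set A : ℝ := x ^ (1 - θ) with hAdef
  have hA : x ^ δ ≤ A := Real.rpow_le_rpow_of_exponent_le hx1 hδle'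
  have hA6 : A ≤ x ^ (1 / 6 : ℝ) := Real.rpow_le_rpow_of_exponent_le hx1 (by linarith)
  have hA' : A ≤ x ^ (1 / 3 + δ) :=
    le_trans hA6 (Real.rpow_le_rpow_of_exponent_le hx1 (by linarith))
  set L : ℝ := Real.log x ^ C with hL
  have hLpos : 0 < L := Real.rpow_pos_of_pos hlogpos C
  obtain ⟨hRB, _⟩ := rows_mul_cols_le_window hx1 hδpos.le (by linarith) hA hA'
  have key := hx₀ x hx₀x A hA hA6
  have hpow : Real.log x ^ (4 * C + 4) = (L ^ 2 * Real.log x ^ 2) ^ 2 := by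
    rw [hL, show (4 : ℝ) * C + 4 = (C + C + 1 + 1) + (C + C + 1 + 1) by ring,
      Real.rpow_add hlogpos, Real.rpow_add hlogpos, Real.rpow_add hlogpos, Real.rpow_add hlogpos,
      Real.rpow_one]
    ring
  have hsqrtT : Real.sqrt (moment lam c x A) ≤ x / (L ^ 2 * Real.log x ^ 2) := by
    rw [hpow] at key
    calc Real.sqrt (moment lam c x A) ≤ Real.sqrt (x ^ 2 / (L ^ 2 * Real.log x ^ 2) ^ 2) :=
          Real.sqrt_le_sqrt key
      _ = x / (L ^ 2 * Real.log x ^ 2) := by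
          rw [← div_pow, Real.sqrt_sq (by positivity)]
  have hcs := sq_sum_abs_colSum_le (f := lam) (c := c) (A₁ := ⌊A⌋₊) (A₂ := ⌊2 * A⌋₊) (B := ⌊x / A⌋₊)
  rw [Nat.card_Ioc] at hcs
  have hmom : momentN lam c ⌊A⌋₊ ⌊2 * A⌋₊ ⌊x / A⌋₊ = moment lam c x A := rfl
  rw [hmom] at hcs
  have hbound : (∑ b ∈ Icc 1 ⌊x / A⌋₊, |colSum lam c ⌊A⌋₊ ⌊2 * A⌋₊ b|) ^ 2 ≤ (x / L) ^ 2 := by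
    calc (∑ b ∈ Icc 1 ⌊x / A⌋₊, |colSum lam c ⌊A⌋₊ ⌊2 * A⌋₊ b|) ^ 2
        ≤ (⌊x / A⌋₊ : ℝ) * ((⌊2 * A⌋₊ - ⌊A⌋₊ : ℕ) : ℝ) * Real.sqrt (moment lam c x A) := hcs
      _ ≤ (2 * x) * (x / (L ^ 2 * Real.log x ^ 2)) := by
          apply mul_le_mul _ hsqrtT (Real.sqrt_nonneg _) (by positivity)
          rw [mul_comm]; exact hRB
      _ ≤ (x / L) ^ 2 := by
          rw [div_pow, show (2 * x) * (x / (L ^ 2 * Real.log x ^ 2)) = x ^ 2 / L ^ 2 * (2 / Real.log x ^ 2) by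
            field_simp]
          apply mul_le_of_le_one_right (by positivity)
          rw [div_le_one (by positivity)]
          nlinarith
  have hnn : 0 ≤ ∑ b ∈ Icc 1 ⌊x / A⌋₊, |colSum lam c ⌊A⌋₊ ⌊2 * A⌋₊ b| :=
    sum_nonneg fun _ _ => abs_nonneg _
  exact (pow_le_pow_iff_left₀ hnn (by positivity) two_ne_zero).mp hbound

end

end Summit.Parity.GeneralizedHardyLittlewood.Cruxes.TableChowla.StrategyCensus
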